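import Mathlib.AlgebraicGeometry.EllipticCurve.Weierstrass
import Mathlib.RingTheory.Valuation.Basic
import HarnessLib

/-!
# The `c₄/c₆` signature of the wild Kodaira normal forms at a place with uniformiser `3` under the
# `LocIrr(3)` valuation criterion: `(ord c₄, ord c₆, ord Δ) = (2,4,3)` (type II) or `(4,7,9)` (type IV*)
# (PURE VALUATION ALGEBRA; cell `b2b-bsdres`, seat `b2b-bsdres-x11b3-p6` GEN 10 as cross-cell pool hand
# under the x11b3 lead's P-POOL rule; theorems only, no curve over `ℚ` is mentioned)

HONEST FRAMING (cell `b2b-bsdres`, run/shared/lean/b2b/bsd-rank1-residual/, verbatim in every file): the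
goal of the cell is to DELETE the COMBINATION-SHAPED residual classes of the Birch–Swinnerton-Dyer formula
for ALL analytic-rank `≤ 1` elliptic curves over `ℚ` — assembled STRICTLY from published theorems — so that
the rank-`≤ 1` remainder becomes exactly the CONSTRUCTION-SHAPED classes, which are TYPED, NOT attempted.
This is not "finishing BSD". Lane CLASS-CLOSURE / team o6 (O6 OPEN); nothing booked; no mark of
`RESIDUAL-MAP.md` moves. This file: ONE public theorem of pure valuation algebra (no definition, no named
fact, no `sorry`), consumed by `Additive/SignatureDichotomyThreeHolds.lean` ((T7) `SignatureDichotomyThree`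
and the `LocIrr(3)` classification on the wild locus at `3`).

## What is proved

**`valuation_signature_of_wild_shape`**: let `w` be a valuation on a field `F` with values in `ℤᵐ⁰`,
`w(3) = exp (−1)` and `w(2) = 1` (e.g. `ℚ` at the place `(3)`), and `Y` a Weierstrass equation over `F`
with `w b₂ ≤ exp(−k₂)`, `w b₄ ≤ exp(−k₄)`, `w b₆ = exp(−k₆)`, `w Δ = exp(−e)`, where
`(k₂,k₄,k₆) = (1,1,1), (1,2,2), (2,3,4), (2,4,5)` and `e ≥ 3, 5, 9, 11` respectively — the normal forms of
the WILD Kodaira types `II, IV, IV*, II*` of Tate's algorithm (Silverman *ATAEC* IV.9.4 Steps 3, 5, 8, 10,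
as delivered by the tree's `WeierstrassCurve.exists_variableChange_b_of_kodairaSymbolAt_wild`, bsd.S15) with
the wild bound `ord Δ_min ≥ m + 2` (`Additive/KodairaCondExpThree`).  If the valuation form of the
`LocIrr(3)` criterion `2·ord c₆ ≥ 3·ord c₄ + 2` holds, namely `(w c₆)² ≤ (w c₄)³ · exp(−2)` (vacuous for
`c₆ = 0`), then **`(k₆, e, w c₄, w c₆) = (1, 3, exp(−2), exp(−4))` (type II, `f = 3`) or
`(4, 9, exp(−4), exp(−7))` (type IV*, `f = 3`)**.  Proof, from Mathlib's `c₄ = b₂² − 24b₄`,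
`c₆ = −b₂³ + 36b₂b₄ − 216b₆`, `1728Δ = c₄³ − c₆²` (`WeierstrassCurve.c_relation`) and the ultrametric
(in)equality: if `w b₂ = exp(−k₂)` the term `b₂³` dominates `c₆` (`ord c₆ = 3k₂`) while `ord c₄ ≥ 2k₂`,
against the criterion; otherwise `216b₆` dominates (`ord c₆ = k₆ + 3`), and in `c₄³ = 1728Δ + c₆²` either
`ord(1728Δ) = e + 3 ≥ 2(k₆ + 3) = ord(c₆²)`, whence `3·ord c₄ ≥ 2·ord c₆` against the criterion, or
`3·ord c₄ = e + 3 < 2k₆ + 6` and the criterion gives `e ≤ 2k₆ + 1`; with `e ≥ m + 2` this leaves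
`e = 3` (II, `ord c₄ = 2`) and `e = 9` (IV*, `ord c₄ = 4`), while IV (`e = 5`, `3·ord c₄ = 8`) and
II* (`e = 11`, `3·ord c₄ = 14`) are impossible.  In Halberstadt–Rizzo / Papadopoulos terms: among the
wild rows at `3` exactly `(2,4,3)` and `(4,7,9)` satisfy `2v(c₆) ≥ 3v(c₄) + 2`.

References: J. H. Silverman, *Advanced Topics in the Arithmetic of Elliptic Curves*, GTM 151 (1994),
IV.9.4 Steps 3, 5, 8, 10 and Table 4.1 [SilvermanATAEC1994]; J. H. Silverman, *The Arithmetic of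
Elliptic Curves*, GTM 106, III.1 [SilvermanAEC2009]; I. Papadopoulos, J. Number Theory 44 (1993)
119–152, Tableau II (`p = 3`).
-/

noncomputable section

open scoped Classical

open WeierstrassCurve WithZero

namespace Summit.BirchSwinnertonDyer.Rank1Residual.Additive

/-! ## §1 Two `ℤᵐ⁰` conveniences -/

section Local

variable {F : Type*} [Field F] (w : Valuation F ℤᵐ⁰)

/-- In `ℤᵐ⁰`: `x ≤ exp n` means `x = exp n` or `x ≤ exp (n − 1)`. [folklore] -/
private theorem eq_or_le_exp_sub_one {x : ℤᵐ⁰} {n : ℤ} (hx : x ≤ exp n) :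
    x = exp n ∨ x ≤ exp (n - 1) := by
  rcases eq_or_ne x 0 with rfl | h0
  · exact Or.inr zero_le
  · rw [← exp_log h0] at hx ⊢
    rcases (exp_le_exp.mp hx).eq_or_lt with h | h
    · exact Or.inl (by rw [h])
    · exact Or.inr (exp_le_exp.mpr (by omega))

/-- In `ℤᵐ⁰`: `(exp a)ⁿ = exp (n·a)`. [folklore] -/
private theorem exp_pow_natCast (a : ℤ) (n : ℕ) : (exp a : ℤᵐ⁰) ^ n = exp ((n : ℤ) * a) := by
  rw [← exp_nsmul, nsmul_eq_mul]

/-! ## §2 The signature of the wild normal forms under the criterion -/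

/-- **The `c₄/c₆` signature of the wild normal forms under the `LocIrr(3)` criterion (pure valuation
algebra).**  Let `w` be a valuation on a field `F` with `w(3) = exp(−1)`, `w(2) = 1`, and `Y` a
Weierstrass equation over `F` with `w b₂ ≤ exp(−k₂)`, `w b₄ ≤ exp(−k₄)`, `w b₆ = exp(−k₆)`,
`w Δ = exp(−e)`, where `(k₂,k₄,k₆)` is `(1,1,1)` with `e ≥ 3` (II), `(1,2,2)` with `e ≥ 5` (IV),
`(2,3,4)` with `e ≥ 9` (IV*) or `(2,4,5)` with `e ≥ 11` (II*), and suppose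
`(w c₆)² ≤ (w c₄)³·exp(−2)` (`2·ord c₆ ≥ 3·ord c₄ + 2`, vacuous for `c₆ = 0`).  Then
`(k₆, e, w c₄, w c₆) = (1, 3, exp(−2), exp(−4))` or `(4, 9, exp(−4), exp(−7))` — type II with signature
`(2,4,3)` or type IV* with `(4,7,9)`, both with `f = e + 1 − m = 3`.  Proof: `c₄ = b₂² − 24b₄`,
`c₆ = −b₂³ + 36b₂b₄ − 216b₆`, `c₄³ = 1728Δ + c₆²`; `ord b₂ = k₂` makes `b₂³` dominate `c₆` and violates
the criterion; else `ord c₆ = k₆ + 3`, and `ord(1728Δ) ≥ ord(c₆²)` violates it too, so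
`3·ord c₄ = e + 3 < 2k₆ + 6`, `e ≤ 2k₆ + 1`, leaving `e = 3` (II) and `e = 9` (IV*).
[cite: SilvermanATAEC1994, IV.9.4 Steps 3, 5, 8, 10 (normal forms) with AEC III.1 (c₄, c₆, Δ)] -/
theorem valuation_signature_of_wild_shape (h3 : w 3 = exp (-1 : ℤ)) (h2 : w 2 = 1)
    (Y : WeierstrassCurve F) {k₂ k₄ k₆ e : ℕ}
    (hb₂ : w Y.b₂ ≤ exp (-(k₂ : ℤ))) (hb₄ : w Y.b₄ ≤ exp (-(k₄ : ℤ)))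
    (hb₆ : w Y.b₆ = exp (-(k₆ : ℤ))) (hΔ : w Y.Δ = exp (-(e : ℤ)))
    (hk : (k₂ = 1 ∧ k₄ = 1 ∧ k₆ = 1 ∧ 3 ≤ e) ∨ (k₂ = 1 ∧ k₄ = 2 ∧ k₆ = 2 ∧ 5 ≤ e) ∨
      (k₂ = 2 ∧ k₄ = 3 ∧ k₆ = 4 ∧ 9 ≤ e) ∨ (k₂ = 2 ∧ k₄ = 4 ∧ k₆ = 5 ∧ 11 ≤ e))
    (hcrit : w Y.c₆ ^ 2 ≤ w Y.c₄ ^ 3 * exp (-2 : ℤ)) :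
    (k₆ = 1 ∧ e = 3 ∧ w Y.c₄ = exp (-2 : ℤ) ∧ w Y.c₆ = exp (-4 : ℤ)) ∨
      (k₆ = 4 ∧ e = 9 ∧ w Y.c₄ = exp (-4 : ℤ) ∧ w Y.c₆ = exp (-7 : ℤ)) := by
  -- numeric bookkeeping on the four admissible `(k₂, k₄, k₆)`
  have i1 : 3 * k₂ < 2 + k₂ + k₄ ∧ 3 * k₂ < 3 + k₆ ∧ 2 * k₂ ≤ 1 + k₄ ∧ 3 + k₆ < 3 * k₂ + 3 ∧
      3 + k₆ < 3 + k₂ + k₄ := by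
    rcases hk with ⟨rfl, rfl, rfl, -⟩ | ⟨rfl, rfl, rfl, -⟩ | ⟨rfl, rfl, rfl, -⟩ |
      ⟨rfl, rfl, rfl, -⟩ <;> omega
  obtain ⟨i1, i2, i3, i4, i5⟩ := i1
  -- valuations of the numerical coefficients
  have h24 : w 24 = exp (-1 : ℤ) := by
    rw [show (24 : F) = 2 ^ 3 * 3 by norm_num, map_mul, map_pow, h2, h3, one_pow, one_mul]
  have h36 : w 36 = exp (-2 : ℤ) := by
    rw [show (36 : F) = 2 ^ 2 * 3 ^ 2 by norm_num, map_mul, map_pow, map_pow, h2, h3, one_pow, one_mul,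
      exp_pow_natCast]
    exact exp_inj.mpr (by norm_num)
  have h216 : w 216 = exp (-3 : ℤ) := by
    rw [show (216 : F) = 2 ^ 3 * 3 ^ 3 by norm_num, map_mul, map_pow, map_pow, h2, h3, one_pow, one_mul,
      exp_pow_natCast]
    exact exp_inj.mpr (by norm_num)
  have h1728 : w 1728 = exp (-3 : ℤ) := by
    rw [show (1728 : F) = 2 ^ 6 * 3 ^ 3 by norm_num, map_mul, map_pow, map_pow, h2, h3, one_pow, one_mul,
      exp_pow_natCast]
    exact exp_inj.mpr (by norm_num)
  have hc₆def : Y.c₆ = (-Y.b₂ ^ 3 + 36 * Y.b₂ * Y.b₄) - 216 * Y.b₆ := by rw [WeierstrassCurve.c₆]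
  have hc₄def : Y.c₄ = Y.b₂ ^ 2 - 24 * Y.b₄ := by rw [WeierstrassCurve.c₄]
  -- the exact term `216 b₆`
  have hT3 : w (216 * Y.b₆) = exp (-(3 + k₆ : ℤ)) := by
    rw [map_mul, h216, hb₆, ← exp_add]; exact exp_inj.mpr (by ring)
  rcases eq_or_le_exp_sub_one hb₂ with hA | hB
  · -- Case A: `ord b₂ = k₂` — `b₂³` dominates `c₆`, against the criterion
    exfalso
    have hT1 : w (-Y.b₂ ^ 3) = exp (-(3 * k₂ : ℤ)) := by
      rw [Valuation.map_neg, map_pow, hA, exp_pow_natCast]; exact exp_inj.mpr (by push_cast; ring)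
    have hT2 : w (36 * Y.b₂ * Y.b₄) ≤ exp (-(2 + k₂ + k₄ : ℤ)) := by
      rw [map_mul, map_mul, h36, hA]
      calc exp (-2 : ℤ) * exp (-(k₂ : ℤ)) * w Y.b₄
          ≤ exp (-2 : ℤ) * exp (-(k₂ : ℤ)) * exp (-(k₄ : ℤ)) := mul_le_mul_right hb₄ _
        _ = exp (-(2 + k₂ + k₄ : ℤ)) := by rw [← exp_add, ← exp_add]; exact exp_inj.mpr (by ring)
    have h12 : w (-Y.b₂ ^ 3 + 36 * Y.b₂ * Y.b₄) = exp (-(3 * k₂ : ℤ)) := by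
      rw [w.map_add_eq_of_lt_left (by rw [hT1]; exact lt_of_le_of_lt hT2 (exp_lt_exp.mpr (by omega))),
        hT1]
    have hc₆ : w Y.c₆ = exp (-(3 * k₂ : ℤ)) := by
      rw [hc₆def, w.map_sub_eq_of_lt_left (by rw [h12, hT3, exp_lt_exp]; omega), h12]
    have hc₄ : w Y.c₄ ≤ exp (-(2 * k₂ : ℤ)) := by
      rw [hc₄def]
      refine w.map_sub_le ?_ ?_
      · rw [map_pow, hA, exp_pow_natCast]; exact exp_le_exp.mpr (by push_cast; omega)
      · rw [map_mul, h24]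
        calc exp (-1 : ℤ) * w Y.b₄ ≤ exp (-1 : ℤ) * exp (-(k₄ : ℤ)) := mul_le_mul_right hb₄ _
          _ ≤ exp (-(2 * k₂ : ℤ)) := by rw [← exp_add, exp_le_exp]; omega
    have key : w Y.c₆ ^ 2 ≤ exp (-(2 * k₂ : ℤ)) ^ 3 * exp (-2 : ℤ) :=
      hcrit.trans (mul_le_mul_left (pow_le_pow_left' hc₄ 3) _)
    rw [hc₆, exp_pow_natCast, exp_pow_natCast, ← exp_add, exp_le_exp] at key
    push_cast at key
    omega
  · -- Case B: `ord b₂ > k₂` — `216 b₆` dominates `c₆`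
    have hS1 : w (-Y.b₂ ^ 3) ≤ exp (((3 : ℕ) : ℤ) * (-(k₂ : ℤ) - 1)) := by
      rw [Valuation.map_neg, map_pow, ← exp_pow_natCast]
      exact pow_le_pow_left' hB 3
    have hS2 : w (36 * Y.b₂ * Y.b₄) ≤ exp (-2 + (-(k₂ : ℤ) - 1) + -(k₄ : ℤ)) := by
      rw [map_mul, map_mul, h36, exp_add, exp_add]
      exact mul_le_mul' (mul_le_mul_right hB _) hb₄
    have h12lt : w (-Y.b₂ ^ 3 + 36 * Y.b₂ * Y.b₄) < w (216 * Y.b₆) := by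
      rw [hT3]
      refine w.map_add_lt (lt_of_le_of_lt hS1 ?_) (lt_of_le_of_lt hS2 ?_)
      · rw [exp_lt_exp]; push_cast; omega
      · rw [exp_lt_exp]; omega
    have hc₆ : w Y.c₆ = exp (-(3 + k₆ : ℤ)) := by
      rw [hc₆def, w.map_sub_eq_of_lt_right h12lt, hT3]
    -- `c₄³ = 1728 Δ + c₆²`
    have hrel : Y.c₄ ^ 3 = 1728 * Y.Δ + Y.c₆ ^ 2 := by rw [Y.c_relation]; ring
    have hA1 : w (1728 * Y.Δ) = exp (-(3 + e : ℤ)) := by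
      rw [map_mul, h1728, hΔ, ← exp_add]; exact exp_inj.mpr (by ring)
    have hA2 : w (Y.c₆ ^ 2) = exp (-(6 + 2 * k₆ : ℤ)) := by
      rw [map_pow, hc₆, exp_pow_natCast]; exact exp_inj.mpr (by push_cast; ring)
    rcases lt_or_ge (3 + e) (6 + 2 * k₆) with hlt6 | hge6
    · -- `1728 Δ` dominates: `3·ord c₄ = e + 3`
      have hlt : w (Y.c₆ ^ 2) < w (1728 * Y.Δ) := by
        rw [hA1, hA2, exp_lt_exp]; omega
      have hc₄3 : w Y.c₄ ^ 3 = exp (-(3 + e : ℤ)) := by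
        rw [← map_pow, hrel, w.map_add_eq_of_lt_left hlt, hA1]
      have hc₄0 : w Y.c₄ ≠ 0 := by
        intro h0
        rw [h0, zero_pow three_ne_zero] at hc₄3
        exact exp_ne_zero hc₄3.symm
      obtain ⟨t, ht⟩ : ∃ t : ℤ, w Y.c₄ = exp t := ⟨_, (exp_log hc₄0).symm⟩
      -- the criterion in terms of `t`
      have hcr := hcrit
      rw [hc₆, ht, exp_pow_natCast, exp_pow_natCast, ← exp_add, exp_le_exp] at hcr
      push_cast at hcr
      rw [ht, exp_pow_natCast, exp_inj] at hc₄3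
      push_cast at hc₄3
      rcases hk with ⟨rfl, rfl, rfl, he⟩ | ⟨rfl, rfl, rfl, he⟩ | ⟨rfl, rfl, rfl, he⟩ |
        ⟨rfl, rfl, rfl, he⟩
      · refine Or.inl ⟨rfl, by omega, ?_, ?_⟩
        · rw [ht]; exact exp_inj.mpr (by omega)
        · rw [hc₆]; exact exp_inj.mpr (by norm_num)
      · exfalso; omega
      · refine Or.inr ⟨rfl, by omega, ?_, ?_⟩
        · rw [ht]; exact exp_inj.mpr (by omega)
        · rw [hc₆]; exact exp_inj.mpr (by norm_num)
      · exfalso; omega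
    · -- `ord(1728 Δ) ≥ ord(c₆²)`: then `3·ord c₄ ≥ 2·ord c₆`, against the criterion
      exfalso
      have hc₄3 : w Y.c₄ ^ 3 ≤ exp (-(6 + 2 * k₆ : ℤ)) := by
        rw [← map_pow, hrel]
        refine w.map_add_le ?_ (le_of_eq hA2)
        rw [hA1, exp_le_exp]; omega
      have key : w Y.c₆ ^ 2 ≤ exp (-(6 + 2 * k₆ : ℤ)) * exp (-2 : ℤ) :=
        hcrit.trans (mul_le_mul_left hc₄3 _)
      rw [hc₆, exp_pow_natCast, ← exp_add, exp_le_exp] at key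
      push_cast at key
      omega

end Local

end Summit.BirchSwinnertonDyer.Rank1Residual.Additive

end
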